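import Summits.BirchSwinnertonDyer.BirchSwinnertonDyer.Theorems.RamifiedHeegnerPairTwistUnitInert
import Summits.BirchSwinnertonDyer.BirchSwinnertonDyer.Theorems.RamifiedHeegnerPairLeafRankZeroUpperAtThreeShimuraInertVariants
import HarnessLib

/-!
# U₀ at the two-SPLIT-carrier Gss2 classes (rank zero; the Shimura rows) — kernel instances of the inert-carrier road, TU₀|inert: the DOORS

Seat `bsd-trib-w-rhp` g14 (TRIBUNAL-W / kit planner) for route `RamifiedHeegnerPair`; helper file `--supports` the crux U₀ `LeafRankZeroUpperAtThree`
(stmt-BirchSwinnertonDyer-26024).  **HONEST FRAMING: theorems only; nothing is booked, no item is closed; U₀ (26024) / TU₀|inert / the Shimura-curve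
Gross–Zagier–Kolyvagin inputs stay research-level and OPEN class-wide; BSD is NOT proved for any curve by this file.**

The rank-ZERO mirror of `RamifiedHeegnerPairTwistUnitInert` (p667190, the U₁ doors): rhp-p2 g10's certificate shape p662479
`LeafShimuraInert.leafRankZeroUpper_three_of_shimuraInertDatum_of_twistUnitZero` (U₀ at a leaf curve `W`, `r_an(W) = 0`, from the six printed facts
`hGZK hmod hnf hJL hCO hHK`, `Addv ∧ SubGss` at `3`, `3 ∤ c(Dt)`, an even inert set `S` of multiplicative primes holding every split carrier, SHAPE, (DEG), and ONE
Jetchev–Skinner–Wan field whose twist has a SIMPLE zero with `ord₃ #Ш_an ≤ 0` at every minimal model) specialised to `S = {q₁, q₂}` and `K = ℚ(√D)`: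
* `leafRankZeroUpper_three_of_twoCarriers_of_sqrtField` — (DEG) by Papikian–Rabinoff at an odd carrier `q₂ ≢ 1 (mod 3)`;
* `leafRankZeroUpper_three_of_twoInert_twoOutside_of_sqrtField` — (DEG) by Pasten–Shimura's two-outside-multiplicative-primes clause (rows `S = {2, q}`,
  `q ≡ 1 (mod 3)`).
Both read the field data off congruences on `D` IN THE KERNEL (inert: `(D/q) = −1`, or `q = 2` and `D ≡ 5 (mod 8)`; split: `(D/ℓ) = +1`, `D ≡ 1 (mod 8)` at `2`;
`Literature.NumberTheory.QuadraticFields.ImaginaryQuadraticPrescribedSplittingInert`) and supply `hTU` for EVERY minimal model of the twist from ONE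
(`shaAn_eq_of_smul_eq_of_smul_eq_of_isGloballyMinimal`).  The per-curve instances `u0_at_<label>` on the rank-zero two-split-carrier Gss2 classes
(51 rows as typed: 44 PR + 7 two-outside; census kits j318150 / j318499: `D`, the minimal twist `Wd = Cd • E^{(D)}` of root number `−1`, `L′(Wd,1)`, a saturated
non-torsion point and the rank-one BSD quotient `X = L′·T²/(Ω·∏c·ĥ) = #Ш(Wd)_an`) follow in the continuation parts `…TwistUnitInertZeroB, …` for every row with a
certified unit twist (the census file `Cruxes/RamifiedPairUpperBound/TU0-INERT-CENSUS.md` says which).  DISPLAYED there (hypotheses, not proved): `N`, `r_an = 0`,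
`Dt` with `3 ∤ c`, `L(E^{(D)},1) = 0`, `L′(E^{(D)},1) ≠ 0`, `#Ш(Wd)_an = qd` with `ord₃ qd ≤ 0`.
[cite: JetchevSkinnerWan2017, §7.4.1–7.4.2, Thm. 4.4.1] [cite: PastenShimura2024, Prop. 6.13, Lemma 6.16, Lemma 6.18] [cite: PapikianRabinoff2016, Cor. 3.5]
[cite: CaiShuTian2014, Thm. 1.5] [cite: GrossZagier1986, V.§2] [cite: Marcus2018, Ch. 3 Thm. 25] [cite: Miller2011LMS, Def. 1.1]
-/

set_option linter.dupNamespace false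
set_option autoImplicit false

noncomputable section

open scoped Classical NumberField

open WeierstrassCurve NumberField IsDedekindDomain IsDedekindDomain.HeightOneSpectrum Rat.HeightOneSpectrum Field Literature Literature.NumberTheory.DiophantineGeometry
  Literature.NumberTheory.EllipticCurves Literature.NumberTheory.EllipticCurves.ModularForms Literature.NumberTheory.EllipticCurves.Rank1Residual
  Literature.NumberTheory.EllipticCurves.Rank1Residual.Typed Literature.NumberTheory.Automorphic Literature.NumberTheory.EllipticCurves.Rank1Residual.X11RankOneCertificates
  Literature.NumberTheory.EllipticCurves.KrizLi2019 Literature.NumberTheory.GaloisRepresentations Literature.NumberTheory.QuadraticFields Literature.NumberTheory.QuadraticFields.Quadratic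
  Summit.BirchSwinnertonDyer.BirchSwinnertonDyer.Rank1Residual Summit.BirchSwinnertonDyer.BirchSwinnertonDyer.Rank1Residual.IntModel
  Summit.BirchSwinnertonDyer.BirchSwinnertonDyer.Rank2Observatory.Tam Summit.BirchSwinnertonDyer.Rank1Residual Summit.BirchSwinnertonDyer.Rank1Residual.Additive
  Summit.BirchSwinnertonDyer.Rank1Residual.X11b Summit.BirchSwinnertonDyer.Rank1Residual.X11b.Three Summit.BirchSwinnertonDyer.Rank1Residual.X9 Summit.BirchSwinnertonDyer.Rank1Residual.GaloisImage
  Summit.BirchSwinnertonDyer.Rank1Residual.Supersingular Summit.BirchSwinnertonDyer.BirchSwinnertonDyer.Theses.RamifiedHeegnerPair Summit.BirchSwinnertonDyer.BirchSwinnertonDyer.Theorems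
  Summit.BirchSwinnertonDyer.BirchSwinnertonDyer.Theorems.SchneiderFree Summit.BirchSwinnertonDyer.BirchSwinnertonDyer.Theorems.RamifiedPairUpperBound
  Summit.BirchSwinnertonDyer.BirchSwinnertonDyer.Theorems.RamifiedHeegnerPairStepLIntrinsic Summit.BirchSwinnertonDyer.BirchSwinnertonDyer.Theorems.AdditiveBranchIMCGordTwoRankOne.HeegnerKolyvagin
  Summit.BirchSwinnertonDyer.BirchSwinnertonDyer.Theorems.RamifiedHeegnerPairTwistUnitIntrinsic Summit.BirchSwinnertonDyer.BirchSwinnertonDyer.Theorems.RamifiedHeegnerPairTwistUnitAdditive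

namespace Summit.BirchSwinnertonDyer.BirchSwinnertonDyer.Theorems.RamifiedHeegnerPairTwistUnitInertZero

open RamifiedHeegnerPairTwistUnitInert

/-! ## §0 The two rank-zero DOORS at `K = ℚ(√D)` -/

/-- **DOOR (rank zero, PR).** `LeafShimuraInert.leafRankZeroUpper_three_of_shimuraInertDatum_of_twistUnitZero` at `S = {q₁, q₂}` (two distinct split
carriers, `q₂` odd, `q₂ ≢ 1 (mod 3)`) and `K = ℚ(√D)`: the field data from congruences on `D`, `hTU` from ONE minimal model of the twist.
CONDITIONAL on every displayed input; BSD is NOT proved by this. [cite: JetchevSkinnerWan2017, §7.4.1] [cite: PapikianRabinoff2016, Cor. 3.5] -/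
theorem leafRankZeroUpper_three_of_twoCarriers_of_sqrtField
    (hGZK : rank_eq_analyticRank_of_analyticRank_le_one) (hmod : hasEntireLFunction_rat)
    (hnf : exists_isNewformOf) (hJL : nonempty_shimuraParametrizationData)
    (hCO : PastenShimura2024_componentOrders)
    (hHK : shimuraCurve_heegnerPoint_grossZagier_kolyvagin)
    (W : WeierstrassCurve ℚ) [W.IsElliptic] [W.IsGloballyMinimal]
    (hadd : Addv W 3) (hsub : SubGss W 3) (hr : W.analyticRank = 0)
    {N : ℕ} [NeZero N] (hN : W.conductorNorm ℤ = N)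
    (Dt : ModularParametrizationData W N) (hc : ¬ (3 : ℤ) ∣ Dt.c)
    {q₁ q₂ : ℕ} [Fact q₁.Prime] [Fact q₂.Prime] (hne : q₁ ≠ q₂)
    (h₁ : W.HasSplitMultiplicativeReductionAtPrime q₁) (h₂ : W.HasSplitMultiplicativeReductionAtPrime q₂)
    (hothers : ∀ (ℓ : ℕ) [Fact ℓ.Prime], ℓ ≠ q₁ → ℓ ≠ q₂ → W.HasSplitMultiplicativeReductionAtPrime ℓ →
      ¬ 3 ∣ padicValInt ℓ W.minimalDiscriminantInt)
    (hshape : ∀ (q : ℕ) [Fact q.Prime], 3 ∣ (W.baseChange ℚ_[q]).localTamagawaNumber ℤ_[q] →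
      W.HasSplitMultiplicativeReductionAtPrime q)
    (hq₂2 : q₂ ≠ 2) (hq₂1 : q₂ % 3 ≠ 1)
    (D : ℤ) [hD : Fact (D < 0)] (hD4 : D % 4 = 1) (hsfN : Squarefree D.natAbs)
    (hi₁ : (q₁ = 2 ∧ D % 8 = 5) ∨ (q₁ ≠ 2 ∧ jacobiSym D q₁ = -1)) (hnd₁ : ¬ (q₁ : ℤ) ∣ D)
    (hi₂ : jacobiSym D q₂ = -1) (hnd₂ : ¬ (q₂ : ℤ) ∣ D)
    (hjac : ∀ ℓ : ℕ, ℓ.Prime → ℓ ∣ W.conductorNorm ℤ → ℓ ≠ q₁ → ℓ ≠ q₂ → ℓ ≠ 2 → jacobiSym D ℓ = 1)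
    (h2 : 2 ∣ W.conductorNorm ℤ → q₁ ≠ 2 → D % 8 = 1)
    (hLt0 : (W.quadraticTwist (D : ℚ)).entireLFunction 1 = 0)
    (hLt1 : deriv (W.quadraticTwist (D : ℚ)).entireLFunction 1 ≠ 0)
    (Wd : WeierstrassCurve ℚ) [Wd.IsElliptic] [Wd.IsGloballyMinimal] (Cd : VariableChange ℚ)
    (hWd : Cd • W.quadraticTwist (D : ℚ) = Wd) {qd : ℚ} (hqd : shaAn Wd = (qd : ℂ)) (hvd : padicValRat 3 qd ≤ 0) :
    MissingUpperBoundAt W 3 := by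
  have hsf : Squarefree D := Int.squarefree_natAbs.mp hsfN
  obtain ⟨hK, hdisc⟩ := isImaginaryQuadratic_and_discr_sqrtField D hD4 hsf
  have h2K := sqrtField.finrank_eq_two D
  have hodd : Odd (NumberField.discr (sqrtField D)) := by rw [hdisc, Int.odd_iff]; omega
  have hin₂ : ((Ideal.span {(q₂ : ℤ)}).primesOver (𝓞 (sqrtField D))).ncard = 1 ∧ ¬ (q₂ : ℤ) ∣ NumberField.discr (sqrtField D) :=
    ⟨ncard_primesOver_eq_one_of_jacobiSym_eq_neg_one h2K (Fact.out : q₂.Prime) (by rw [hdisc]; exact hi₂), by rw [hdisc]; exact hnd₂⟩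
  have hin₁ : ((Ideal.span {(q₁ : ℤ)}).primesOver (𝓞 (sqrtField D))).ncard = 1 ∧ ¬ (q₁ : ℤ) ∣ NumberField.discr (sqrtField D) := by
    refine ⟨?_, by rw [hdisc]; exact hnd₁⟩
    rcases hi₁ with ⟨h12, h5⟩ | ⟨-, hj⟩
    · subst h12
      have h := ncard_primesOver_two_eq_one_of_discr_mod_eight h2K (by rw [hdisc]; exact h5)
      simpa using h
    · exact ncard_primesOver_eq_one_of_jacobiSym_eq_neg_one h2K (Fact.out : q₁.Prime) (by rw [hdisc]; exact hj)
  have hTU : ∀ (Wd' : WeierstrassCurve ℚ) [Wd'.IsElliptic] [Wd'.IsGloballyMinimal] (Cd' : VariableChange ℚ),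
      Cd' • W.quadraticTwist (NumberField.discr (sqrtField D) : ℚ) = Wd' →
        ∃ qd : ℚ, shaAn Wd' = (qd : ℂ) ∧ padicValRat 3 qd ≤ 0 := by
    intro Wd' _ _ Cd' hWd'
    rw [hdisc] at hWd'
    exact ⟨qd, (shaAn_eq_of_smul_eq_of_smul_eq_of_isGloballyMinimal hWd hWd').trans hqd, hvd⟩
  have hq₁S : ∀ {ℓ : ℕ}, ℓ ∉ ({q₁, q₂} : Finset ℕ) → ℓ ≠ q₁ := fun h h' ↦ h (by simp [h'])
  have hq₂S : ∀ {ℓ : ℕ}, ℓ ∉ ({q₁, q₂} : Finset ℕ) → ℓ ≠ q₂ := fun h h' ↦ h (by simp [h'])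
  refine LeafShimuraInert.leafRankZeroUpper_three_of_shimuraInertDatum_of_twistUnitZero hGZK hmod hnf hJL hCO hHK W hadd hsub hr hN Dt hc
    {q₁, q₂}
    ?_ ?_ (fun ℓ _ hℓ hs ↦ hothers ℓ (hq₁S hℓ) (hq₂S hℓ) hs) hshape
    (Or.inr (Or.inr ⟨q₁, q₂, rfl, hne, hq₂2, hq₂1⟩))
    (sqrtField D) hK hodd ?_ (fun ℓ hℓ hℓN hℓS ↦ ?_) (by rw [hdisc]; exact hLt0) (by rw [hdisc]; exact hLt1) hTU
  · rw [Finset.card_insert_of_notMem (by simpa using hne), Finset.card_singleton]; decide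
  · intro ℓ hℓ
    rcases Finset.mem_insert.mp hℓ with rfl | hℓ
    · exact ⟨inferInstance, h₁.hasMultiplicativeReductionAtPrime⟩
    · rw [Finset.mem_singleton] at hℓ; subst hℓ
      exact ⟨inferInstance, h₂.hasMultiplicativeReductionAtPrime⟩
  · intro ℓ hℓ
    rcases Finset.mem_insert.mp hℓ with rfl | hℓ
    · exact hin₁
    · rw [Finset.mem_singleton] at hℓ; subst hℓ
      exact hin₂
  · by_cases hℓ2 : ℓ = 2
    · subst hℓ2
      have h := ncard_primesOver_two_sqrtField_eq_two D (h2 hℓN (Ne.symm (hq₁S hℓS))) hsf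
      simpa using h
    · exact ncard_primesOver_sqrtField_eq_two_of_jacobiSym D hD4 hsf hℓ hℓ2 (hjac ℓ hℓ hℓN (hq₁S hℓS) (hq₂S hℓS) hℓ2)

/-- **DOOR (rank zero, two outside primes).** The same with (DEG) from two multiplicative primes `ℓ₀, t` outside `S = {q₁, q₂}`, `3 ∤ ord_{ℓ₀} Δ_min`
(Pasten–Shimura's clause; rows `S = {2, q}`, `q ≡ 1 (mod 3)`).  CONDITIONAL; BSD is NOT proved by this. [cite: PastenShimura2024, Lemma 6.16] -/
theorem leafRankZeroUpper_three_of_twoInert_twoOutside_of_sqrtField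
    (hGZK : rank_eq_analyticRank_of_analyticRank_le_one) (hmod : hasEntireLFunction_rat)
    (hnf : exists_isNewformOf) (hJL : nonempty_shimuraParametrizationData)
    (hCO : PastenShimura2024_componentOrders)
    (hHK : shimuraCurve_heegnerPoint_grossZagier_kolyvagin)
    (W : WeierstrassCurve ℚ) [W.IsElliptic] [W.IsGloballyMinimal]
    (hadd : Addv W 3) (hsub : SubGss W 3) (hr : W.analyticRank = 0)
    {N : ℕ} [NeZero N] (hN : W.conductorNorm ℤ = N)
    (Dt : ModularParametrizationData W N) (hc : ¬ (3 : ℤ) ∣ Dt.c)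
    {q₁ q₂ : ℕ} [Fact q₁.Prime] [Fact q₂.Prime] (hne : q₁ ≠ q₂)
    (h₁ : W.HasSplitMultiplicativeReductionAtPrime q₁) (h₂ : W.HasSplitMultiplicativeReductionAtPrime q₂)
    (hothers : ∀ (ℓ : ℕ) [Fact ℓ.Prime], ℓ ≠ q₁ → ℓ ≠ q₂ → W.HasSplitMultiplicativeReductionAtPrime ℓ →
      ¬ 3 ∣ padicValInt ℓ W.minimalDiscriminantInt)
    (hshape : ∀ (q : ℕ) [Fact q.Prime], 3 ∣ (W.baseChange ℚ_[q]).localTamagawaNumber ℤ_[q] →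
      W.HasSplitMultiplicativeReductionAtPrime q)
    (ℓ₀ t : ℕ) [Fact ℓ₀.Prime] [Fact t.Prime] (hℓ₀ : W.HasMultiplicativeReductionAtPrime ℓ₀) (ht : W.HasMultiplicativeReductionAtPrime t)
    (hℓ₀1 : ℓ₀ ≠ q₁) (hℓ₀2 : ℓ₀ ≠ q₂) (ht1 : t ≠ q₁) (ht2 : t ≠ q₂) (htℓ : t ≠ ℓ₀)
    (hv₀ : ¬ 3 ∣ padicValInt ℓ₀ W.minimalDiscriminantInt)
    (D : ℤ) [hD : Fact (D < 0)] (hD4 : D % 4 = 1) (hsfN : Squarefree D.natAbs)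
    (hi₁ : (q₁ = 2 ∧ D % 8 = 5) ∨ (q₁ ≠ 2 ∧ jacobiSym D q₁ = -1)) (hnd₁ : ¬ (q₁ : ℤ) ∣ D)
    (hi₂ : jacobiSym D q₂ = -1) (hnd₂ : ¬ (q₂ : ℤ) ∣ D)
    (hjac : ∀ ℓ : ℕ, ℓ.Prime → ℓ ∣ W.conductorNorm ℤ → ℓ ≠ q₁ → ℓ ≠ q₂ → ℓ ≠ 2 → jacobiSym D ℓ = 1)
    (h2 : 2 ∣ W.conductorNorm ℤ → q₁ ≠ 2 → D % 8 = 1)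
    (hLt0 : (W.quadraticTwist (D : ℚ)).entireLFunction 1 = 0)
    (hLt1 : deriv (W.quadraticTwist (D : ℚ)).entireLFunction 1 ≠ 0)
    (Wd : WeierstrassCurve ℚ) [Wd.IsElliptic] [Wd.IsGloballyMinimal] (Cd : VariableChange ℚ)
    (hWd : Cd • W.quadraticTwist (D : ℚ) = Wd) {qd : ℚ} (hqd : shaAn Wd = (qd : ℂ)) (hvd : padicValRat 3 qd ≤ 0) :
    MissingUpperBoundAt W 3 := by
  have hsf : Squarefree D := Int.squarefree_natAbs.mp hsfN
  obtain ⟨hK, hdisc⟩ := isImaginaryQuadratic_and_discr_sqrtField D hD4 hsf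
  have h2K := sqrtField.finrank_eq_two D
  have hodd : Odd (NumberField.discr (sqrtField D)) := by rw [hdisc, Int.odd_iff]; omega
  have hin₂ : ((Ideal.span {(q₂ : ℤ)}).primesOver (𝓞 (sqrtField D))).ncard = 1 ∧ ¬ (q₂ : ℤ) ∣ NumberField.discr (sqrtField D) :=
    ⟨ncard_primesOver_eq_one_of_jacobiSym_eq_neg_one h2K (Fact.out : q₂.Prime) (by rw [hdisc]; exact hi₂), by rw [hdisc]; exact hnd₂⟩
  have hin₁ : ((Ideal.span {(q₁ : ℤ)}).primesOver (𝓞 (sqrtField D))).ncard = 1 ∧ ¬ (q₁ : ℤ) ∣ NumberField.discr (sqrtField D) := by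
    refine ⟨?_, by rw [hdisc]; exact hnd₁⟩
    rcases hi₁ with ⟨h12, h5⟩ | ⟨-, hj⟩
    · subst h12
      have h := ncard_primesOver_two_eq_one_of_discr_mod_eight h2K (by rw [hdisc]; exact h5)
      simpa using h
    · exact ncard_primesOver_eq_one_of_jacobiSym_eq_neg_one h2K (Fact.out : q₁.Prime) (by rw [hdisc]; exact hj)
  have hTU : ∀ (Wd' : WeierstrassCurve ℚ) [Wd'.IsElliptic] [Wd'.IsGloballyMinimal] (Cd' : VariableChange ℚ),
      Cd' • W.quadraticTwist (NumberField.discr (sqrtField D) : ℚ) = Wd' →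
        ∃ qd : ℚ, shaAn Wd' = (qd : ℂ) ∧ padicValRat 3 qd ≤ 0 := by
    intro Wd' _ _ Cd' hWd'
    rw [hdisc] at hWd'
    exact ⟨qd, (shaAn_eq_of_smul_eq_of_smul_eq_of_isGloballyMinimal hWd hWd').trans hqd, hvd⟩
  have hq₁S : ∀ {ℓ : ℕ}, ℓ ∉ ({q₁, q₂} : Finset ℕ) → ℓ ≠ q₁ := fun h h' ↦ h (by simp [h'])
  have hq₂S : ∀ {ℓ : ℕ}, ℓ ∉ ({q₁, q₂} : Finset ℕ) → ℓ ≠ q₂ := fun h h' ↦ h (by simp [h'])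
  have hnotin : ∀ {ℓ : ℕ}, ℓ ≠ q₁ → ℓ ≠ q₂ → ℓ ∉ ({q₁, q₂} : Finset ℕ) := fun h h' hm ↦ by
    rcases Finset.mem_insert.mp hm with rfl | hm
    · exact h rfl
    · exact h' (Finset.mem_singleton.mp hm)
  refine LeafShimuraInert.leafRankZeroUpper_three_of_shimuraInertDatum_of_twistUnitZero hGZK hmod hnf hJL hCO hHK W hadd hsub hr hN Dt hc
    {q₁, q₂}
    ?_ ?_ (fun ℓ _ hℓ hs ↦ hothers ℓ (hq₁S hℓ) (hq₂S hℓ) hs) hshape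
    (Or.inr (Or.inl ⟨ℓ₀, t, ‹_›, ‹_›, hℓ₀, ht, hnotin hℓ₀1 hℓ₀2, hnotin ht1 ht2, htℓ, hv₀⟩))
    (sqrtField D) hK hodd ?_ (fun ℓ hℓ hℓN hℓS ↦ ?_) (by rw [hdisc]; exact hLt0) (by rw [hdisc]; exact hLt1) hTU
  · rw [Finset.card_insert_of_notMem (by simpa using hne), Finset.card_singleton]; decide
  · intro ℓ hℓ
    rcases Finset.mem_insert.mp hℓ with rfl | hℓ
    · exact ⟨inferInstance, h₁.hasMultiplicativeReductionAtPrime⟩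
    · rw [Finset.mem_singleton] at hℓ; subst hℓ
      exact ⟨inferInstance, h₂.hasMultiplicativeReductionAtPrime⟩
  · intro ℓ hℓ
    rcases Finset.mem_insert.mp hℓ with rfl | hℓ
    · exact hin₁
    · rw [Finset.mem_singleton] at hℓ; subst hℓ
      exact hin₂
  · by_cases hℓ2 : ℓ = 2
    · subst hℓ2
      have h := ncard_primesOver_two_sqrtField_eq_two D (h2 hℓN (Ne.symm (hq₁S hℓS))) hsf
      simpa using h
    · exact ncard_primesOver_sqrtField_eq_two_of_jacobiSym D hD4 hsf hℓ hℓ2 (hjac ℓ hℓ hℓN (hq₁S hℓS) (hq₂S hℓS) hℓ2)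

end Summit.BirchSwinnertonDyer.BirchSwinnertonDyer.Theorems.RamifiedHeegnerPairTwistUnitInertZero

end
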